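import Mathlib
import HarnessLib

/-!
# ValiantsHypothesis / LacunarySymmetroid — crux `MatrixDescartes` (stmt-ValiantsHypothesis-18050, V1),
# line `Cruxes/MatrixDescartes/Lines/osculation_law.lean` («osculation-law»), stub `stub_recursion`, general position (ROUTE′):
# THE BORDERED LOG-HESSIAN OF A PRODUCT (algebraic identity behind the witness certificates, NOTE-p7g13 §3/§9)

For the bordered log-Hessian `H(Φ) = θ₀²Φ·(θ₁Φ)² − 2·θ₀θ₁Φ·θ₀Φ·θ₁Φ + θ₁²Φ·(θ₀Φ)²` (`θ_i = X_i·∂_i`, the Euler operators) and a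
PRODUCT `Φ = L·M` of polynomials in two variables:

  `H(L·M) = M³·H(L) + L·Q(L, M)`   for an explicit polynomial `Q` in `L, M` and their Euler derivatives,

hence `L ∣ H(L·M) − M³·H(L)`: on the zero set of `L` (and modulo `L` in the polynomial ring — this is what coprimality
certificates need, also at complex points) the log-Hessian of the product is `M³` times the log-Hessian of the factor.  Used for
product-shaped (diagonal) witness pencils, where every node curve is a product of rank-one sheets.

* **`logHessian_mul`** — the identity with the explicit cofactor.
* **`dvd_logHessian_mul_sub`** — `L ∣ H(L·M) − M³·H(L)`.
* `eval_logHessian_mul_of_eval_eq_zero` — the evaluation form at a zero of `L`.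

Honest framing: an algebraic LEMMA toward the OPEN stub `stub_recursion` (its density residue); nothing of the summit is proved;
`VP ≠ VNP` is NOT proved.  No definitions, no named facts.
-/

-- `Summit.ValiantsHypothesis.ValiantsHypothesis.…` is the tree's mandated single-conjunct layout (Sub = Summit).
set_option linter.dupNamespace false

noncomputable section

namespace Summit.ValiantsHypothesis.ValiantsHypothesis.Theorems.LacunarySymmetroidMatrixDescartes

namespace OsculationGeneric

set_option maxHeartbeats 400000 in
/-- **The bordered log-Hessian of a product**: `H(L·M) = M³·H(L) + L·Q`. [folklore] -/
theorem logHessian_mul (L M : MvPolynomial (Fin 2) ℝ) :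
    (MvPolynomial.X 0 * MvPolynomial.pderiv 0 (MvPolynomial.X 0 * MvPolynomial.pderiv 0 (L * M))
            * (MvPolynomial.X 1 * MvPolynomial.pderiv 1 (L * M)) ^ 2
          - 2 * (MvPolynomial.X 0 * MvPolynomial.pderiv 0 (MvPolynomial.X 1 * MvPolynomial.pderiv 1 (L * M)))
            * (MvPolynomial.X 0 * MvPolynomial.pderiv 0 (L * M)) * (MvPolynomial.X 1 * MvPolynomial.pderiv 1 (L * M))
          + MvPolynomial.X 1 * MvPolynomial.pderiv 1 (MvPolynomial.X 1 * MvPolynomial.pderiv 1 (L * M))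
            * (MvPolynomial.X 0 * MvPolynomial.pderiv 0 (L * M)) ^ 2) =
      M ^ 3 * (MvPolynomial.X 0 * MvPolynomial.pderiv 0 (MvPolynomial.X 0 * MvPolynomial.pderiv 0 L)
            * (MvPolynomial.X 1 * MvPolynomial.pderiv 1 L) ^ 2
          - 2 * (MvPolynomial.X 0 * MvPolynomial.pderiv 0 (MvPolynomial.X 1 * MvPolynomial.pderiv 1 L))
            * (MvPolynomial.X 0 * MvPolynomial.pderiv 0 L) * (MvPolynomial.X 1 * MvPolynomial.pderiv 1 L)
          + MvPolynomial.X 1 * MvPolynomial.pderiv 1 (MvPolynomial.X 1 * MvPolynomial.pderiv 1 L)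
            * (MvPolynomial.X 0 * MvPolynomial.pderiv 0 L) ^ 2)
      + L * (-2 * (MvPolynomial.X 1 * MvPolynomial.pderiv 1 L) * (MvPolynomial.X 0 * MvPolynomial.pderiv 0 (MvPolynomial.X 1 * MvPolynomial.pderiv 1 L)) * M ^ 2 * (MvPolynomial.X 0 * MvPolynomial.pderiv 0 M) + 2 * (MvPolynomial.X 1 * MvPolynomial.pderiv 1 L) * (MvPolynomial.X 0 * MvPolynomial.pderiv 0 (MvPolynomial.X 0 * MvPolynomial.pderiv 0 L)) * M ^ 2 * (MvPolynomial.X 1 * MvPolynomial.pderiv 1 M) - 2 * (MvPolynomial.X 1 * MvPolynomial.pderiv 1 L) ^ 2 * M * (MvPolynomial.X 0 * MvPolynomial.pderiv 0 M) ^ 2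
        + (MvPolynomial.X 1 * MvPolynomial.pderiv 1 L) ^ 2 * M ^ 2 * (MvPolynomial.X 0 * MvPolynomial.pderiv 0 (MvPolynomial.X 0 * MvPolynomial.pderiv 0 M)) + 2 * (MvPolynomial.X 0 * MvPolynomial.pderiv 0 L) * (MvPolynomial.X 1 * MvPolynomial.pderiv 1 (MvPolynomial.X 1 * MvPolynomial.pderiv 1 L)) * M ^ 2 * (MvPolynomial.X 0 * MvPolynomial.pderiv 0 M) - 2 * (MvPolynomial.X 0 * MvPolynomial.pderiv 0 L) * (MvPolynomial.X 0 * MvPolynomial.pderiv 0 (MvPolynomial.X 1 * MvPolynomial.pderiv 1 L)) * M ^ 2 * (MvPolynomial.X 1 * MvPolynomial.pderiv 1 M)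
        + 4 * (MvPolynomial.X 0 * MvPolynomial.pderiv 0 L) * (MvPolynomial.X 1 * MvPolynomial.pderiv 1 L) * M * (MvPolynomial.X 0 * MvPolynomial.pderiv 0 M) * (MvPolynomial.X 1 * MvPolynomial.pderiv 1 M) - 2 * (MvPolynomial.X 0 * MvPolynomial.pderiv 0 L) * (MvPolynomial.X 1 * MvPolynomial.pderiv 1 L) * M ^ 2 * (MvPolynomial.X 0 * MvPolynomial.pderiv 0 (MvPolynomial.X 1 * MvPolynomial.pderiv 1 M)) - 2 * (MvPolynomial.X 0 * MvPolynomial.pderiv 0 L) ^ 2 * M * (MvPolynomial.X 1 * MvPolynomial.pderiv 1 M) ^ 2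
        + (MvPolynomial.X 0 * MvPolynomial.pderiv 0 L) ^ 2 * M ^ 2 * (MvPolynomial.X 1 * MvPolynomial.pderiv 1 (MvPolynomial.X 1 * MvPolynomial.pderiv 1 M)) + L * (MvPolynomial.X 1 * MvPolynomial.pderiv 1 (MvPolynomial.X 1 * MvPolynomial.pderiv 1 L)) * M * (MvPolynomial.X 0 * MvPolynomial.pderiv 0 M) ^ 2 - 2 * L * (MvPolynomial.X 0 * MvPolynomial.pderiv 0 (MvPolynomial.X 1 * MvPolynomial.pderiv 1 L)) * M * (MvPolynomial.X 0 * MvPolynomial.pderiv 0 M) * (MvPolynomial.X 1 * MvPolynomial.pderiv 1 M) + L * (MvPolynomial.X 0 * MvPolynomial.pderiv 0 (MvPolynomial.X 0 * MvPolynomial.pderiv 0 L)) * M * (MvPolynomial.X 1 * MvPolynomial.pderiv 1 M) ^ 2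
        + 2 * L * (MvPolynomial.X 1 * MvPolynomial.pderiv 1 L) * M * (MvPolynomial.X 1 * MvPolynomial.pderiv 1 M) * (MvPolynomial.X 0 * MvPolynomial.pderiv 0 (MvPolynomial.X 0 * MvPolynomial.pderiv 0 M)) - 2 * L * (MvPolynomial.X 1 * MvPolynomial.pderiv 1 L) * M * (MvPolynomial.X 0 * MvPolynomial.pderiv 0 M) * (MvPolynomial.X 0 * MvPolynomial.pderiv 0 (MvPolynomial.X 1 * MvPolynomial.pderiv 1 M)) - 2 * L * (MvPolynomial.X 0 * MvPolynomial.pderiv 0 L) * M * (MvPolynomial.X 1 * MvPolynomial.pderiv 1 M) * (MvPolynomial.X 0 * MvPolynomial.pderiv 0 (MvPolynomial.X 1 * MvPolynomial.pderiv 1 M))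
        + 2 * L * (MvPolynomial.X 0 * MvPolynomial.pderiv 0 L) * M * (MvPolynomial.X 0 * MvPolynomial.pderiv 0 M) * (MvPolynomial.X 1 * MvPolynomial.pderiv 1 (MvPolynomial.X 1 * MvPolynomial.pderiv 1 M)) + L ^ 2 * (MvPolynomial.X 1 * MvPolynomial.pderiv 1 M) ^ 2 * (MvPolynomial.X 0 * MvPolynomial.pderiv 0 (MvPolynomial.X 0 * MvPolynomial.pderiv 0 M)) - 2 * L ^ 2 * (MvPolynomial.X 0 * MvPolynomial.pderiv 0 M) * (MvPolynomial.X 1 * MvPolynomial.pderiv 1 M) * (MvPolynomial.X 0 * MvPolynomial.pderiv 0 (MvPolynomial.X 1 * MvPolynomial.pderiv 1 M)) + L ^ 2 * (MvPolynomial.X 0 * MvPolynomial.pderiv 0 M) ^ 2 * (MvPolynomial.X 1 * MvPolynomial.pderiv 1 (MvPolynomial.X 1 * MvPolynomial.pderiv 1 M))) := by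
  simp only [MvPolynomial.pderiv_X_self, Derivation.leibniz, map_add, smul_eq_mul]
  ring

/-- `L ∣ H(L·M) − M³·H(L)`. [folklore] -/
theorem dvd_logHessian_mul_sub (L M : MvPolynomial (Fin 2) ℝ) :
    L ∣ (MvPolynomial.X 0 * MvPolynomial.pderiv 0 (MvPolynomial.X 0 * MvPolynomial.pderiv 0 (L * M))
            * (MvPolynomial.X 1 * MvPolynomial.pderiv 1 (L * M)) ^ 2
          - 2 * (MvPolynomial.X 0 * MvPolynomial.pderiv 0 (MvPolynomial.X 1 * MvPolynomial.pderiv 1 (L * M)))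
            * (MvPolynomial.X 0 * MvPolynomial.pderiv 0 (L * M)) * (MvPolynomial.X 1 * MvPolynomial.pderiv 1 (L * M))
          + MvPolynomial.X 1 * MvPolynomial.pderiv 1 (MvPolynomial.X 1 * MvPolynomial.pderiv 1 (L * M))
            * (MvPolynomial.X 0 * MvPolynomial.pderiv 0 (L * M)) ^ 2) - M ^ 3 * (MvPolynomial.X 0 * MvPolynomial.pderiv 0 (MvPolynomial.X 0 * MvPolynomial.pderiv 0 L)
            * (MvPolynomial.X 1 * MvPolynomial.pderiv 1 L) ^ 2
          - 2 * (MvPolynomial.X 0 * MvPolynomial.pderiv 0 (MvPolynomial.X 1 * MvPolynomial.pderiv 1 L))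
            * (MvPolynomial.X 0 * MvPolynomial.pderiv 0 L) * (MvPolynomial.X 1 * MvPolynomial.pderiv 1 L)
          + MvPolynomial.X 1 * MvPolynomial.pderiv 1 (MvPolynomial.X 1 * MvPolynomial.pderiv 1 L)
            * (MvPolynomial.X 0 * MvPolynomial.pderiv 0 L) ^ 2) :=
  ⟨(-2 * (MvPolynomial.X 1 * MvPolynomial.pderiv 1 L) * (MvPolynomial.X 0 * MvPolynomial.pderiv 0 (MvPolynomial.X 1 * MvPolynomial.pderiv 1 L)) * M ^ 2 * (MvPolynomial.X 0 * MvPolynomial.pderiv 0 M) + 2 * (MvPolynomial.X 1 * MvPolynomial.pderiv 1 L) * (MvPolynomial.X 0 * MvPolynomial.pderiv 0 (MvPolynomial.X 0 * MvPolynomial.pderiv 0 L)) * M ^ 2 * (MvPolynomial.X 1 * MvPolynomial.pderiv 1 M) - 2 * (MvPolynomial.X 1 * MvPolynomial.pderiv 1 L) ^ 2 * M * (MvPolynomial.X 0 * MvPolynomial.pderiv 0 M) ^ 2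
        + (MvPolynomial.X 1 * MvPolynomial.pderiv 1 L) ^ 2 * M ^ 2 * (MvPolynomial.X 0 * MvPolynomial.pderiv 0 (MvPolynomial.X 0 * MvPolynomial.pderiv 0 M)) + 2 * (MvPolynomial.X 0 * MvPolynomial.pderiv 0 L) * (MvPolynomial.X 1 * MvPolynomial.pderiv 1 (MvPolynomial.X 1 * MvPolynomial.pderiv 1 L)) * M ^ 2 * (MvPolynomial.X 0 * MvPolynomial.pderiv 0 M) - 2 * (MvPolynomial.X 0 * MvPolynomial.pderiv 0 L) * (MvPolynomial.X 0 * MvPolynomial.pderiv 0 (MvPolynomial.X 1 * MvPolynomial.pderiv 1 L)) * M ^ 2 * (MvPolynomial.X 1 * MvPolynomial.pderiv 1 M)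
        + 4 * (MvPolynomial.X 0 * MvPolynomial.pderiv 0 L) * (MvPolynomial.X 1 * MvPolynomial.pderiv 1 L) * M * (MvPolynomial.X 0 * MvPolynomial.pderiv 0 M) * (MvPolynomial.X 1 * MvPolynomial.pderiv 1 M) - 2 * (MvPolynomial.X 0 * MvPolynomial.pderiv 0 L) * (MvPolynomial.X 1 * MvPolynomial.pderiv 1 L) * M ^ 2 * (MvPolynomial.X 0 * MvPolynomial.pderiv 0 (MvPolynomial.X 1 * MvPolynomial.pderiv 1 M)) - 2 * (MvPolynomial.X 0 * MvPolynomial.pderiv 0 L) ^ 2 * M * (MvPolynomial.X 1 * MvPolynomial.pderiv 1 M) ^ 2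
        + (MvPolynomial.X 0 * MvPolynomial.pderiv 0 L) ^ 2 * M ^ 2 * (MvPolynomial.X 1 * MvPolynomial.pderiv 1 (MvPolynomial.X 1 * MvPolynomial.pderiv 1 M)) + L * (MvPolynomial.X 1 * MvPolynomial.pderiv 1 (MvPolynomial.X 1 * MvPolynomial.pderiv 1 L)) * M * (MvPolynomial.X 0 * MvPolynomial.pderiv 0 M) ^ 2 - 2 * L * (MvPolynomial.X 0 * MvPolynomial.pderiv 0 (MvPolynomial.X 1 * MvPolynomial.pderiv 1 L)) * M * (MvPolynomial.X 0 * MvPolynomial.pderiv 0 M) * (MvPolynomial.X 1 * MvPolynomial.pderiv 1 M) + L * (MvPolynomial.X 0 * MvPolynomial.pderiv 0 (MvPolynomial.X 0 * MvPolynomial.pderiv 0 L)) * M * (MvPolynomial.X 1 * MvPolynomial.pderiv 1 M) ^ 2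
        + 2 * L * (MvPolynomial.X 1 * MvPolynomial.pderiv 1 L) * M * (MvPolynomial.X 1 * MvPolynomial.pderiv 1 M) * (MvPolynomial.X 0 * MvPolynomial.pderiv 0 (MvPolynomial.X 0 * MvPolynomial.pderiv 0 M)) - 2 * L * (MvPolynomial.X 1 * MvPolynomial.pderiv 1 L) * M * (MvPolynomial.X 0 * MvPolynomial.pderiv 0 M) * (MvPolynomial.X 0 * MvPolynomial.pderiv 0 (MvPolynomial.X 1 * MvPolynomial.pderiv 1 M)) - 2 * L * (MvPolynomial.X 0 * MvPolynomial.pderiv 0 L) * M * (MvPolynomial.X 1 * MvPolynomial.pderiv 1 M) * (MvPolynomial.X 0 * MvPolynomial.pderiv 0 (MvPolynomial.X 1 * MvPolynomial.pderiv 1 M))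
        + 2 * L * (MvPolynomial.X 0 * MvPolynomial.pderiv 0 L) * M * (MvPolynomial.X 0 * MvPolynomial.pderiv 0 M) * (MvPolynomial.X 1 * MvPolynomial.pderiv 1 (MvPolynomial.X 1 * MvPolynomial.pderiv 1 M)) + L ^ 2 * (MvPolynomial.X 1 * MvPolynomial.pderiv 1 M) ^ 2 * (MvPolynomial.X 0 * MvPolynomial.pderiv 0 (MvPolynomial.X 0 * MvPolynomial.pderiv 0 M)) - 2 * L ^ 2 * (MvPolynomial.X 0 * MvPolynomial.pderiv 0 M) * (MvPolynomial.X 1 * MvPolynomial.pderiv 1 M) * (MvPolynomial.X 0 * MvPolynomial.pderiv 0 (MvPolynomial.X 1 * MvPolynomial.pderiv 1 M)) + L ^ 2 * (MvPolynomial.X 0 * MvPolynomial.pderiv 0 M) ^ 2 * (MvPolynomial.X 1 * MvPolynomial.pderiv 1 (MvPolynomial.X 1 * MvPolynomial.pderiv 1 M))), by rw [logHessian_mul]; ring⟩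

/-- At a zero of `L`, `H(L·M) = M³·H(L)` (evaluated). [folklore] -/
theorem eval_logHessian_mul_of_eval_eq_zero (L M : MvPolynomial (Fin 2) ℝ) (p : Fin 2 → ℝ) (hL : MvPolynomial.eval p L = 0) :
    MvPolynomial.eval p (MvPolynomial.X 0 * MvPolynomial.pderiv 0 (MvPolynomial.X 0 * MvPolynomial.pderiv 0 (L * M))
            * (MvPolynomial.X 1 * MvPolynomial.pderiv 1 (L * M)) ^ 2
          - 2 * (MvPolynomial.X 0 * MvPolynomial.pderiv 0 (MvPolynomial.X 1 * MvPolynomial.pderiv 1 (L * M)))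
            * (MvPolynomial.X 0 * MvPolynomial.pderiv 0 (L * M)) * (MvPolynomial.X 1 * MvPolynomial.pderiv 1 (L * M))
          + MvPolynomial.X 1 * MvPolynomial.pderiv 1 (MvPolynomial.X 1 * MvPolynomial.pderiv 1 (L * M))
            * (MvPolynomial.X 0 * MvPolynomial.pderiv 0 (L * M)) ^ 2) =
      MvPolynomial.eval p M ^ 3 * MvPolynomial.eval p (MvPolynomial.X 0 * MvPolynomial.pderiv 0 (MvPolynomial.X 0 * MvPolynomial.pderiv 0 L)
            * (MvPolynomial.X 1 * MvPolynomial.pderiv 1 L) ^ 2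
          - 2 * (MvPolynomial.X 0 * MvPolynomial.pderiv 0 (MvPolynomial.X 1 * MvPolynomial.pderiv 1 L))
            * (MvPolynomial.X 0 * MvPolynomial.pderiv 0 L) * (MvPolynomial.X 1 * MvPolynomial.pderiv 1 L)
          + MvPolynomial.X 1 * MvPolynomial.pderiv 1 (MvPolynomial.X 1 * MvPolynomial.pderiv 1 L)
            * (MvPolynomial.X 0 * MvPolynomial.pderiv 0 L) ^ 2) := by
  rw [logHessian_mul, RingHom.map_add, RingHom.map_mul, RingHom.map_mul, RingHom.map_pow, hL, zero_mul, add_zero]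

end OsculationGeneric

end Summit.ValiantsHypothesis.ValiantsHypothesis.Theorems.LacunarySymmetroidMatrixDescartes

end
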